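import Summits.NavierStokesRegularity.NavierStokesRegularity.Theorems.CoriolisHeadFarFieldShellMean
import Summits.NavierStokesRegularity.NavierStokesRegularity.Theorems.CoriolisHeadFarFieldOscillation
import HarnessLib

/-!
# CoriolisHeadFarFieldLimit — crux `NoCoRotatingCore` (stmt-NavierStokesRegularity-22676), line `far_field_constancy` v2
# (skeleton `Cruxes/NoCoRotatingCore/Lines/far_field_constancy.lean` 15c9a82ad206abb9, ns-idea-10 g2): **stub K1b
# `stub_farFieldLimit` PROVED BY NAME** (ns-s29-p2 g2, DIRECTOR-NS nsreg #149 (1))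

K1b: a bounded smooth rotated Leray profile with SCALE-NATURAL DERIVATIVE DECAY (`|y|‖DU‖ + |y|²‖D²U‖ → 0`, the open stub K1a)
has a uniform far-field LIMIT `U(y) → b`.

PROOF (differs from the line card's Newtonian-potential / harmonic-Liouville / characteristics sketch; same statement).
(1) The equation gives `∇P = −(aI + B)U + E`, `‖E‖ ≤ (3ν + a + ‖B‖ + M)·δ` beyond the K1a radius of tolerance `δ`
(`CoriolisHead.norm_gradient_add_le_of_rotated`), and `|ΔP| = |tr(DU∘DU)| ≤ 3‖DU‖² ≤ 3/|y|²` beyond the radius of tolerance `1`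
(`abs_laplacian_le_of_rotated`).  (2) SHELL-MEAN LEMMA (`CoriolisHead.shellMean_sub_shellMean_le`, Green's second identity against
`K_R = Γ∞^{R,2R} − Γ∞^{2R,4R}`): the dyadic shell means `m_i(n) = ∫ λ^{2ⁿR₁, 2ⁿ⁺¹R₁} ∂_iP` satisfy `|m_i(n) − m_i(n+1)| ≤ C/2ⁿ`, hence
converge.  (3) On a dyadic shell `U` oscillates by `≤ 24δ` (`norm_sub_le_of_shell`), so `∇P` oscillates by `O(δ)` there and differs
from its shell mean by `O(δ)` (`abs_shellMean_sub_le`).  (4) Hence `∇P`, then `(aI+B)U`, then `U` (coercivity `a‖v‖ ≤ ‖av + Bv‖`)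
are Cauchy at infinity; completeness of `ℝ³` gives the limit `b`.  No rate is claimed (that is K1c).

HONEST FRAMING: K1b is a SUPPORT stub; K1a (`stub_scaleNaturalDecay`), K1c (`stub_typeIRate`) and the residual
`stub_pineauVicolConjecture` stay OPEN; nothing here proves `NoCoRotatingCore`, Pineau–Vicol's Conjecture 1.1 or NS regularity.
-/

noncomputable section

open MeasureTheory Set Function Filter Topology Metric InnerProductSpace Real
open scoped RealInnerProductSpace Laplacian ContDiff

set_option linter.dupNamespace false

namespace Summit.NavierStokesRegularity.NavierStokesRegularity.Theorems.CoriolisHead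

open Literature.Analysis.FluidPDE

/-! ## §1 Three elementary lemmas -/

/-- `‖v‖ ≤ Σᵢ |⟪v, bᵢ⟫|` for the standard orthonormal basis of `ℝ³`. -/
theorem norm_le_sum_abs_inner_basisFun (v : (EuclideanSpace ℝ (Fin 3))) :
    ‖v‖ ≤ ∑ i, |⟪v, EuclideanSpace.basisFun (Fin 3) ℝ i⟫| := by
  set b := EuclideanSpace.basisFun (Fin 3) ℝ with hb
  have hrepr : ∑ i, ⟪b i, v⟫ • b i = v := b.sum_repr' v
  calc ‖v‖ = ‖∑ i, ⟪b i, v⟫ • b i‖ := by rw [hrepr]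
    _ ≤ ∑ i, ‖⟪b i, v⟫ • b i‖ := norm_sum_le _ _
    _ = ∑ i, |⟪v, b i⟫| := by
        refine Finset.sum_congr rfl fun i _ => ?_
        rw [norm_smul, b.orthonormal.1 i, mul_one, Real.norm_eq_abs, real_inner_comm]

/-- dyadic location: every `y` with `2ᴺ R₁ ≤ |y|` lies in a dyadic shell `2ⁿR₁ ≤ |y| ≤ 2·2ⁿR₁` with `n ≥ N`. -/
theorem exists_dyadic_shell {R₁ : ℝ} (hR₁ : 0 < R₁) (N : ℕ) {y : (EuclideanSpace ℝ (Fin 3))} (hy : 2 ^ N * R₁ ≤ ‖y‖) :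
    ∃ n : ℕ, N ≤ n ∧ 2 ^ n * R₁ ≤ ‖y‖ ∧ ‖y‖ ≤ 2 * (2 ^ n * R₁) := by
  have hpos : 0 < 2 ^ N * R₁ := by positivity
  have hx : 1 ≤ ‖y‖ / (2 ^ N * R₁) := by rwa [le_div_iff₀ hpos, one_mul]
  obtain ⟨k, hk1, hk2⟩ := exists_nat_pow_near hx one_lt_two
  refine ⟨N + k, Nat.le_add_right _ _, ?_, ?_⟩
  · rw [le_div_iff₀ hpos] at hk1
    calc (2 : ℝ) ^ (N + k) * R₁ = 2 ^ k * (2 ^ N * R₁) := by rw [pow_add]; ring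
      _ ≤ ‖y‖ := hk1
  · rw [div_lt_iff₀ hpos] at hk2
    calc ‖y‖ ≤ 2 ^ (k + 1) * (2 ^ N * R₁) := hk2.le
      _ = 2 * (2 ^ (N + k) * R₁) := by rw [pow_add, pow_succ]; ring

/-- Cauchy at infinity ⇒ limit at infinity (completeness of `ℝ³`; the ray `k ↦ k·b₀` is a Cauchy sequence). -/
theorem exists_limit_of_cauchy_atInfinity {f : (EuclideanSpace ℝ (Fin 3)) → (EuclideanSpace ℝ (Fin 3))}
    (h : ∀ ε : ℝ, 0 < ε → ∃ R : ℝ, ∀ y y' : (EuclideanSpace ℝ (Fin 3)), R ≤ ‖y‖ → R ≤ ‖y'‖ → ‖f y - f y'‖ ≤ ε) :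
    ∃ b : (EuclideanSpace ℝ (Fin 3)), ∀ ε : ℝ, 0 < ε → ∃ R : ℝ, ∀ y : (EuclideanSpace ℝ (Fin 3)), R ≤ ‖y‖ → ‖f y - b‖ ≤ ε := by
  set e₀ : (EuclideanSpace ℝ (Fin 3)) := EuclideanSpace.basisFun (Fin 3) ℝ 0 with he₀
  have he : ‖e₀‖ = 1 := (EuclideanSpace.basisFun (Fin 3) ℝ).orthonormal.1 0
  set u : ℕ → (EuclideanSpace ℝ (Fin 3)) := fun k => f ((k : ℝ) • e₀) with hu
  have hnorm : ∀ k : ℕ, ‖(k : ℝ) • e₀‖ = k := fun k => by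
    rw [norm_smul, he, mul_one, Real.norm_of_nonneg (Nat.cast_nonneg k)]
  have hcs : CauchySeq u := by
    refine Metric.cauchySeq_iff.2 fun ε hε => ?_
    obtain ⟨R, hR⟩ := h (ε / 2) (by positivity)
    obtain ⟨N, hN⟩ := exists_nat_gt R
    refine ⟨N, fun m hm n hn => ?_⟩
    rw [dist_eq_norm]
    have hm' : R ≤ ‖(m : ℝ) • e₀‖ := by rw [hnorm]; exact hN.le.trans (by exact_mod_cast hm)
    have hn' : R ≤ ‖(n : ℝ) • e₀‖ := by rw [hnorm]; exact hN.le.trans (by exact_mod_cast hn)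
    exact (hR _ _ hm' hn').trans_lt (by linarith)
  obtain ⟨b, hb⟩ := cauchySeq_tendsto_of_complete hcs
  refine ⟨b, fun ε hε => ?_⟩
  obtain ⟨R, hR⟩ := h (ε / 2) (by positivity)
  obtain ⟨K, hK⟩ := Metric.tendsto_atTop.1 hb (ε / 2) (by positivity)
  obtain ⟨N, hN⟩ := exists_nat_gt R
  set k := max K N with hk
  refine ⟨R, fun y hy => ?_⟩
  have hk' : R ≤ ‖(k : ℝ) • e₀‖ := by
    rw [hnorm]; exact hN.le.trans (by exact_mod_cast le_max_right K N)
  have h1 := hR y _ hy hk'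
  have h2 : ‖u k - b‖ < ε / 2 := by rw [← dist_eq_norm]; exact hK k (le_max_left _ _)
  calc ‖f y - b‖ = ‖(f y - u k) + (u k - b)‖ := by rw [sub_add_sub_cancel]
    _ ≤ ‖f y - u k‖ + ‖u k - b‖ := norm_add_le _ _
    _ ≤ ε := by linarith

/-- `⟪∇P(y), v⟫ = DP(y) v`. -/
theorem inner_gradient_eq_fderiv (P : (EuclideanSpace ℝ (Fin 3)) → ℝ) (y v : (EuclideanSpace ℝ (Fin 3))) : ⟪gradient P y, v⟫ = fderiv ℝ P y v := by
  rw [gradient, InnerProductSpace.toDual_symm_apply]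

/-! ## §2 Stub K1b by name -/

-- the skeleton of record states the stub with this local notation; the header below is its text verbatim
local notation "E3" => EuclideanSpace ℝ (Fin 3)

/-- **stub K1b — `stub_farFieldLimit`** of the line `far_field_constancy` (crux `CoriolisHead.NoCoRotatingCore`, item 22676),
statement VERBATIM from the skeleton of record: scale-natural derivative decay forces a uniform far-field limit `U(y) → b`.
Proof: shell-mean lemma for `∇P` (Green's second identity against the dyadic kernels `Γ∞^{R,2R} − Γ∞^{2R,4R}`, with
`|ΔP| ≤ 3/|y|²` from the pressure Poisson equation) + oscillation decay on dyadic shells + coercivity of `aI + B`; see the module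
docstring.  K1a, K1c, the Pineau–Vicol residual, `NoCoRotatingCore` and NS regularity are NOT proved here. -/
theorem stub_farFieldLimit :
    ∀ (ν a : ℝ), 0 < ν → 0 < a → ∀ (B : E3 →L[ℝ] E3) (U : E3 → E3) (P : E3 → ℝ),
      ContDiff ℝ (⊤ : ℕ∞) U → ContDiff ℝ 2 P → (∀ x, inner ℝ (B x) x = 0) →
      Literature.Analysis.FluidPDE.VectorCalculus.IsDivFree U →
      (∀ y, -(ν • Laplacian.laplacian U y) + a • U y + a • fderiv ℝ U y y
        + (B (U y) - fderiv ℝ U y (B y)) + Literature.Analysis.FluidPDE.convect U U y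
        + gradient P y = 0) →
      (∃ M : ℝ, ∀ y, ‖U y‖ ≤ M) →
      (∀ ε : ℝ, 0 < ε → ∃ R : ℝ, ∀ y, R ≤ ‖y‖ →
        ‖y‖ * ‖fderiv ℝ U y‖ + ‖y‖ ^ 2 * ‖iteratedFDeriv ℝ 2 U y‖ ≤ ε) →
      ∃ b : E3, (∀ ε : ℝ, 0 < ε → ∃ R : ℝ, ∀ y, R ≤ ‖y‖ → ‖U y - b‖ ≤ ε) := by
  intro ν a hν ha B U P hU hP hB hdiv heq hbdd hdec
  obtain ⟨M, hM⟩ := hbdd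
  have hM0 : 0 ≤ M := (norm_nonneg _).trans (hM 0)
  have hPs : ContDiff ℝ ∞ P := contDiff_pressure_of_rotated hU (hP.of_le (by norm_num)) heq
  have hU2 : ContDiff ℝ 2 U := hU.of_le (by norm_cast)
  have hUd : Differentiable ℝ U := hU.differentiable (by simp)
  have hqc : ∀ v : E3, Continuous fun z => fderiv ℝ P z v := fun v =>
    (hPs.continuous_fderiv (by simp)).clm_apply continuous_const
  set bas := EuclideanSpace.basisFun (Fin 3) ℝ with hbas
  have hbas1 : ∀ i, ‖bas i‖ = 1 := fun i => bas.orthonormal.1 i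
  -- the constants
  obtain ⟨CΓ, hCΓ0, hCΓ⟩ := exists_sq_mul_norm_fderiv_newtonFar_le
  set C₀ : ℝ := 128 * (volume (ball (0 : E3) 1)).toReal * CΓ with hC₀
  have hC₀0 : 0 ≤ C₀ := by positivity
  set Cl : ℝ := ∫ w : E3, |newtonFarLaplacian 1 2 w| with hCl
  have hCl0 : 0 ≤ Cl := integral_nonneg fun _ => abs_nonneg _
  set A : ℝ := a + ‖B‖ with hA
  have hA0 : 0 ≤ A := by positivity
  set C₁ : ℝ := 3 * ν + a + ‖B‖ + M with hC₁
  have hC₁0 : 0 ≤ C₁ := by positivity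
  set C₂ : ℝ := 2 * C₁ + 24 * A with hC₂
  set C₃ : ℝ := 6 * (Cl * C₂ + 1) + 2 * C₁ with hC₃
  have hC₃0 : 0 ≤ C₃ := by positivity
  -- consequences of the decay hypothesis at tolerance `δ`, beyond `max R_δ 1`
  have hgrad : ∀ {δ Rδ : ℝ}, (∀ y : E3, Rδ ≤ ‖y‖ → ‖y‖ * ‖fderiv ℝ U y‖ + ‖y‖ ^ 2 * ‖iteratedFDeriv ℝ 2 U y‖ ≤ δ) →
      ∀ y : E3, max Rδ 1 ≤ ‖y‖ → ‖gradient P y + (a • U y + B (U y))‖ ≤ C₁ * δ := by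
    intro δ Rδ hRδ y hy
    have hy1 : 1 ≤ ‖y‖ := (le_max_right _ _).trans hy
    have hd := hRδ y ((le_max_left _ _).trans hy)
    have hnn1 : 0 ≤ ‖y‖ * ‖fderiv ℝ U y‖ := by positivity
    have hnn2 : 0 ≤ ‖y‖ ^ 2 * ‖iteratedFDeriv ℝ 2 U y‖ := by positivity
    have hle1 : ‖fderiv ℝ U y‖ ≤ ‖y‖ * ‖fderiv ℝ U y‖ := le_mul_of_one_le_left (norm_nonneg _) hy1
    have hle2 : ‖iteratedFDeriv ℝ 2 U y‖ ≤ ‖y‖ ^ 2 * ‖iteratedFDeriv ℝ 2 U y‖ :=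
      le_mul_of_one_le_left (norm_nonneg _) (one_le_pow₀ hy1)
    have hD1 : ‖fderiv ℝ U y‖ ≤ δ := by linarith
    have hD2 : ‖iteratedFDeriv ℝ 2 U y‖ ≤ δ := by linarith
    have hyD : ‖y‖ * ‖fderiv ℝ U y‖ ≤ δ := by linarith
    have h := norm_gradient_add_le_of_rotated hν.le ha.le hU2 heq y
    calc ‖gradient P y + (a • U y + B (U y))‖
        ≤ 3 * ν * ‖iteratedFDeriv ℝ 2 U y‖ + (a + ‖B‖) * (‖y‖ * ‖fderiv ℝ U y‖) + ‖U y‖ * ‖fderiv ℝ U y‖ := h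
      _ ≤ 3 * ν * δ + (a + ‖B‖) * δ + M * δ := by
          refine add_le_add (add_le_add ?_ ?_) ?_
          · exact mul_le_mul_of_nonneg_left hD2 (by positivity)
          · exact mul_le_mul_of_nonneg_left hyD hA0
          · exact mul_le_mul (hM y) hD1 (norm_nonneg _) hM0
      _ = C₁ * δ := by rw [hC₁]; ring
  have hDU : ∀ {δ Rδ : ℝ}, (∀ y : E3, Rδ ≤ ‖y‖ → ‖y‖ * ‖fderiv ℝ U y‖ + ‖y‖ ^ 2 * ‖iteratedFDeriv ℝ 2 U y‖ ≤ δ) →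
      ∀ {ρ : ℝ}, max Rδ 1 ≤ ρ / 2 → ∀ w : E3, ρ / 2 ≤ ‖w‖ → ‖fderiv ℝ U w‖ ≤ 2 * δ / ρ := by
    intro δ Rδ hRδ ρ hρ w hw
    have hw1 : 1 ≤ ‖w‖ := (le_max_right _ _).trans (hρ.trans hw)
    have hd := hRδ w ((le_max_left _ _).trans (hρ.trans hw))
    have hwD : ‖w‖ * ‖fderiv ℝ U w‖ ≤ δ := by nlinarith [norm_nonneg (iteratedFDeriv ℝ 2 U w)]
    have hρ0 : 0 < ρ := by linarith [hρ, le_max_right Rδ 1]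
    rw [le_div_iff₀ hρ0]
    nlinarith [norm_nonneg (fderiv ℝ U w)]
  -- STEP 1: `|ΔP| ≤ 3/|z|²` beyond `R₁ ≥ 1`
  obtain ⟨R₁', hR₁'⟩ := hdec 1 one_pos
  set R₁ : ℝ := max R₁' 1 with hR₁def
  have hR₁1 : 1 ≤ R₁ := le_max_right _ _
  have hR₁0 : 0 < R₁ := by linarith
  have hΔ : ∀ z : E3, R₁ ≤ ‖z‖ → |(Δ P) z| ≤ 3 / ‖z‖ ^ 2 := by
    intro z hz
    have hz0 : 0 < ‖z‖ := by linarith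
    have hd := hR₁' z ((le_max_left _ _).trans hz)
    have hD : ‖fderiv ℝ U z‖ ≤ 1 / ‖z‖ := by
      rw [le_div_iff₀ hz0, mul_comm]; nlinarith [norm_nonneg (iteratedFDeriv ℝ 2 U z)]
    calc |(Δ P) z| ≤ 3 * ‖fderiv ℝ U z‖ ^ 2 := abs_laplacian_le_of_rotated hU hP hdiv heq z
      _ ≤ 3 * (1 / ‖z‖) ^ 2 := by gcongr
      _ = 3 / ‖z‖ ^ 2 := by field_simp
  -- STEP 2: dyadic shell means of `∂ᵢP` converge
  set ρ : ℕ → ℝ := fun n => 2 ^ n * R₁ with hρ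
  have hρpos : ∀ n, 0 < ρ n := fun n => by positivity
  have hρR₁ : ∀ n, R₁ ≤ ρ n := fun n => le_mul_of_one_le_left hR₁0.le (one_le_pow₀ (by norm_num))
  have hρsucc : ∀ n, ρ (n + 1) = 2 * ρ n := fun n => by simp only [hρ, pow_succ]; ring
  set q : Fin 3 → E3 → ℝ := fun i z => fderiv ℝ P z (bas i) with hq
  set m : Fin 3 → ℕ → ℝ := fun i n => ∫ z, newtonFarLaplacian (ρ n) (2 * ρ n) z * q i z with hm
  have hstep : ∀ i n, dist (m i n) (m i (n + 1)) ≤ (C₀ * 3 / R₁) * (1 / 2) ^ n := by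
    intro i n
    have h := shellMean_sub_shellMean_le hCΓ0 hCΓ hPs (K := 3) (by norm_num) hR₁0 hΔ (hρR₁ n) (bas i)
    rw [hbas1 i, mul_one] at h
    have e2 : m i (n + 1) = ∫ z, newtonFarLaplacian (2 * ρ n) (4 * ρ n) z * q i z := by
      simp only [hm, hρsucc n, show (2 : ℝ) * (2 * ρ n) = 4 * ρ n by ring]
    rw [Real.dist_eq, e2]
    refine h.trans (le_of_eq ?_)
    have hρn : (ρ n : ℝ) = 2 ^ n * R₁ := rfl
    rw [hρn, hC₀, one_div, inv_pow]
    field_simp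
  have hcauchy : ∀ i, CauchySeq (m i) := fun i =>
    cauchySeq_of_le_geometric (1 / 2) (C₀ * 3 / R₁) (by norm_num) (hstep i)
  choose g hg using fun i => cauchySeq_tendsto_of_complete (hcauchy i)
  -- STEP 3: `U` is Cauchy at infinity
  have hmain : ∀ ε : ℝ, 0 < ε → ∃ R : ℝ, ∀ y y' : E3, R ≤ ‖y‖ → R ≤ ‖y'‖ → ‖U y - U y'‖ ≤ ε := by
    intro ε hε
    set δ : ℝ := a * ε / (C₃ + 1) with hδ
    have hδ0 : 0 < δ := by positivity
    obtain ⟨Rδ, hRδ⟩ := hdec δ hδ0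
    -- tails of the three convergent sequences
    have htail : ∀ i, ∃ Nᵢ : ℕ, ∀ n, Nᵢ ≤ n → |m i n - g i| ≤ δ := fun i => by
      obtain ⟨Nᵢ, hN⟩ := Metric.tendsto_atTop.1 (hg i) δ hδ0
      exact ⟨Nᵢ, fun n hn => by rw [← Real.dist_eq]; exact (hN n hn).le⟩
    choose Nt hNt using htail
    -- a dyadic index beyond which the shells are outside `max Rδ 1` (with room `ρ/2`)
    obtain ⟨Nρ, hNρ⟩ := pow_unbounded_of_one_lt (2 * max Rδ 1) (one_lt_two (α := ℝ))
    set N : ℕ := max (max (Nt 0) (Nt 1)) (max (Nt 2) Nρ) with hN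
    have hNt' : ∀ i, Nt i ≤ N := by
      intro i; fin_cases i <;> simp [hN]
    have hNρ' : Nρ ≤ N := le_max_of_le_right (le_max_right _ _)
    have hshell_far : ∀ n, N ≤ n → max Rδ 1 ≤ ρ n / 2 := by
      intro n hn
      have h2 : (2 : ℝ) ^ Nρ ≤ 2 ^ n := pow_le_pow_right₀ (by norm_num) (hNρ'.trans hn)
      have : 2 * max Rδ 1 ≤ ρ n := by
        calc 2 * max Rδ 1 ≤ 2 ^ Nρ := hNρ.le
          _ ≤ 2 ^ n := h2
          _ ≤ 2 ^ n * R₁ := le_mul_of_one_le_right (by positivity) hR₁1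
      linarith
    -- the key pointwise estimate: beyond `ρ N`, every `∂ᵢP(y)` is within `(Cl C₂ + 1)δ` of `gᵢ`
    have hkey : ∀ y : E3, ρ N ≤ ‖y‖ → ∀ i, |q i y - g i| ≤ (Cl * C₂ + 1) * δ := by
      intro y hy i
      obtain ⟨n, hNn, hy1, hy2⟩ := exists_dyadic_shell hR₁0 N (by simpa [hρ] using hy)
      have hfar := hshell_far n hNn
      have hηw := hDU hRδ hfar
      -- oscillation of `∂ᵢP` on the shell around the value at `y`
      have hosc : ∀ z : E3, ρ n ≤ ‖z‖ → ‖z‖ ≤ 2 * ρ n → |q i z - q i y| ≤ C₂ * δ := by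
        intro z hz1 hz2
        have hzfar : max Rδ 1 ≤ ‖z‖ := hfar.trans (by linarith)
        have hyfar : max Rδ 1 ≤ ‖y‖ := hfar.trans (by linarith)
        have hUosc : ‖U z - U y‖ ≤ 12 * ρ n * (2 * δ / ρ n) :=
          norm_sub_le_of_shell (hρpos n).le (by positivity) hUd hηw hz1 hz2 hy1 hy2
        have hUosc' : ‖U z - U y‖ ≤ 24 * δ := by
          have hρn : ρ n ≠ 0 := (hρpos n).ne'
          refine hUosc.trans (le_of_eq ?_); field_simp; ring
        have hgz := hgrad hRδ z hzfar
        have hgy := hgrad hRδ y hyfar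
        have hVdiff : ‖(a • U z + B (U z)) - (a • U y + B (U y))‖ ≤ A * (24 * δ) := by
          have e : (a • U z + B (U z)) - (a • U y + B (U y)) = a • (U z - U y) + B (U z - U y) := by
            rw [smul_sub, map_sub]; abel
          rw [e]
          calc ‖a • (U z - U y) + B (U z - U y)‖ ≤ ‖a • (U z - U y)‖ + ‖B (U z - U y)‖ := norm_add_le _ _
            _ ≤ a * ‖U z - U y‖ + ‖B‖ * ‖U z - U y‖ := by
                rw [norm_smul, Real.norm_of_nonneg ha.le]
                exact add_le_add le_rfl (B.le_opNorm _)
            _ = A * ‖U z - U y‖ := by rw [hA]; ring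
            _ ≤ A * (24 * δ) := mul_le_mul_of_nonneg_left hUosc' hA0
        have hgraddiff : ‖gradient P z - gradient P y‖ ≤ C₂ * δ := by
          have e : gradient P z - gradient P y = (gradient P z + (a • U z + B (U z))) -
              (gradient P y + (a • U y + B (U y))) - ((a • U z + B (U z)) - (a • U y + B (U y))) := by abel
          rw [e]
          calc ‖(gradient P z + (a • U z + B (U z))) - (gradient P y + (a • U y + B (U y))) -
                ((a • U z + B (U z)) - (a • U y + B (U y)))‖
              ≤ ‖gradient P z + (a • U z + B (U z))‖ + ‖gradient P y + (a • U y + B (U y))‖ +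
                ‖(a • U z + B (U z)) - (a • U y + B (U y))‖ :=
                  (norm_sub_le _ _).trans (add_le_add (norm_sub_le _ _) le_rfl)
            _ ≤ C₁ * δ + C₁ * δ + A * (24 * δ) := add_le_add (add_le_add hgz hgy) hVdiff
            _ = C₂ * δ := by rw [hC₂]; ring
        calc |q i z - q i y| = |⟪gradient P z - gradient P y, bas i⟫| := by
              simp only [hq, inner_sub_left, inner_gradient_eq_fderiv]
          _ ≤ ‖gradient P z - gradient P y‖ * ‖bas i‖ := abs_real_inner_le_norm _ _
          _ ≤ C₂ * δ := by rw [hbas1 i, mul_one]; exact hgraddiff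
      have hmean : |m i n - q i y| ≤ Cl * (C₂ * δ) := abs_shellMean_sub_le (hρpos n) (hqc (bas i)) hosc
      have ht : |m i n - g i| ≤ δ := hNt i n ((hNt' i).trans hNn)
      calc |q i y - g i| = |(m i n - g i) - (m i n - q i y)| := by ring_nf
        _ ≤ |m i n - g i| + |m i n - q i y| := abs_sub _ _
        _ ≤ δ + Cl * (C₂ * δ) := add_le_add ht hmean
        _ = (Cl * C₂ + 1) * δ := by ring
    refine ⟨ρ N, fun y y' hy hy' => ?_⟩
    have hyfar : max Rδ 1 ≤ ‖y‖ := (hshell_far N le_rfl).trans (by linarith [hρpos N])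
    have hy'far : max Rδ 1 ≤ ‖y'‖ := (hshell_far N le_rfl).trans (by linarith [hρpos N])
    -- `∇P(y) − ∇P(y')` is small componentwise, hence in norm
    have hgradyy : ‖gradient P y - gradient P y'‖ ≤ 6 * (Cl * C₂ + 1) * δ := by
      calc ‖gradient P y - gradient P y'‖ ≤ ∑ i, |⟪gradient P y - gradient P y', bas i⟫| :=
            norm_le_sum_abs_inner_basisFun _
        _ ≤ ∑ _i : Fin 3, 2 * ((Cl * C₂ + 1) * δ) := by
            refine Finset.sum_le_sum fun i _ => ?_
            have e : ⟪gradient P y - gradient P y', bas i⟫ = (q i y - g i) - (q i y' - g i) := by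
              simp only [hq, inner_sub_left, inner_gradient_eq_fderiv]; ring
            rw [e]
            exact (abs_sub _ _).trans (by linarith [hkey y hy i, hkey y' hy' i])
        _ = 6 * (Cl * C₂ + 1) * δ := by simp; ring
    -- hence `(aI+B)(U y − U y')` is small, hence `U y − U y'`
    have hV : ‖a • (U y - U y') + B (U y - U y')‖ ≤ C₃ * δ := by
      have e : a • (U y - U y') + B (U y - U y') = (gradient P y + (a • U y + B (U y))) -
          (gradient P y' + (a • U y' + B (U y'))) - (gradient P y - gradient P y') := by
        rw [smul_sub, map_sub]; abel
      rw [e]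
      calc ‖(gradient P y + (a • U y + B (U y))) - (gradient P y' + (a • U y' + B (U y'))) -
            (gradient P y - gradient P y')‖
          ≤ ‖gradient P y + (a • U y + B (U y))‖ + ‖gradient P y' + (a • U y' + B (U y'))‖ +
            ‖gradient P y - gradient P y'‖ := (norm_sub_le _ _).trans (add_le_add (norm_sub_le _ _) le_rfl)
        _ ≤ C₁ * δ + C₁ * δ + 6 * (Cl * C₂ + 1) * δ := add_le_add (add_le_add (hgrad hRδ y hyfar) (hgrad hRδ y' hy'far)) hgradyy
        _ = C₃ * δ := by rw [hC₃]; ring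
    have hcoer : a * ‖U y - U y'‖ ≤ ‖a • (U y - U y') + B (U y - U y')‖ := mul_norm_le_norm_of_skew hB (U y - U y')
    have hfin : a * ‖U y - U y'‖ ≤ C₃ * δ := hcoer.trans hV
    have haε : 0 < a * ε := mul_pos ha hε
    have hδe : C₃ * δ ≤ a * ε :=
      calc C₃ * δ = C₃ * (a * ε) / (C₃ + 1) := by rw [hδ]; ring
        _ ≤ (C₃ + 1) * (a * ε) / (C₃ + 1) := by gcongr; linarith
        _ = a * ε := by field_simp
    exact le_of_mul_le_mul_left (hfin.trans hδe) ha
  -- STEP 4: the limit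
  exact exists_limit_of_cauchy_atInfinity hmain

end Summit.NavierStokesRegularity.NavierStokesRegularity.Theorems.CoriolisHead

end
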